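import Literature.AlgebraicGeometry.Resolution.Hauser2010
import Mathlib.RingTheory.MvPowerSeries.NoZeroDivisors
import Mathlib.RingTheory.MvPolynomial.Ideal
import Mathlib.RingTheory.MvPolynomial.Homogeneous
import Literature.RingTheory.MvPolynomial.IdealOfVarsBasics
import HarnessLib

/-!
# The order `ord₀ P` of a polynomial at the origin — the ring-theoretic API

`Literature/AlgebraicGeometry/Resolution/OrdZeroBasics.lean` (HIRONAKA-L discharge lane, librarian res-D-lib-2,
dedupe hoist LIB #16; DEF-FREE). `Hauser2010.ordZero P := (↑P : MvPowerSeries σ K).order` ([Hauser2010] §C, file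
`Resolution/Hauser2010.lean`) is the order of vanishing of `P ∈ K[X_σ]` at the origin; it is used by ≈ 200 files of the
resolution programme (residual orders of bed cells, Moh/Hauser–Perlega shade computations, CJS near points, …), and its
elementary algebra was re-derived per file — publicly only on the Summits side (`…W46MohWindowShadeFormalBranch`:
`ordZero_mul`, `ordZero_pow`, `ordZero_neg`, `le_ordZero_add`; bed files: `ordZero_C`, `ordZero_monomial`; `ToricGuard`)
and privately on the Literature side (`Res.BinomialPointOrder`, `Res.CentreBlowupThm36*`, `Res.PointBlowupFlagStepTyped`,
`Giraud1983`). Stated ONCE here, σ-generic, from Mathlib's `MvPowerSeries.order` API: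

* size: `ordZero_eq_top_iff`, `exists_ordZero_eq_natCast`, `ne_zero_of_ordZero_eq_natCast`, `coe_toNat_ordZero`,
  `le_toNat_ordZero_iff`, `coeff_eq_zero_of_degree_lt_ordZero`, `natCast_le_ordZero_iff_forall_coeff`;
* **the bridge to the powers of the ideal of the variables**: `natCast_le_ordZero_iff_mem_idealOfVars_pow`
  (`n ≤ ord₀ P ↔ P ∈ 𝔪₀ⁿ`), `one_le_ordZero_iff`, `ordZero_eq_zero_iff`;
* algebra: `le_ordZero_mul`, `ordZero_mul` (no zero divisors), `le_ordZero_pow`, `ordZero_pow`, `min_ordZero_le_ordZero_add`,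
  `le_ordZero_add`, `ordZero_add_of_ordZero_ne`, `ordZero_add_eq_left_of_lt`, `le_ordZero_sum`, `ordZero_neg`, sub forms,
  `le_ordZero_mul_left/right`, `ordZero_C_mul_of_isUnit`;
* values: `ordZero_monomial`, `ordZero_X`, `ordZero_X_pow`, `ordZero_C`, `ordZero_one`, `ordZero_of_isHomogeneous`;
* change of coefficients: `le_ordZero_map`, `ordZero_map_of_injective`.

Already in the tree (cite, not restated): `Hauser2010.ordZero_zero`, `Hauser2010.ordZero_eq_nat_iff`;
`Literature.Barriers.ResolutionOfSingularities.HauserPerlega.natCast_le_ordZero_iff` (support form), `ordZero_eq_inf_support`,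
`ordZero_le_degree_of_mem_support`, `ordZero_expand`, `ordZero_rename`, `le_ordZero_of_forall(_mem_support)`,
`ordZero_le_of_coeff_ne_zero`, `ordZero_ne_top`; `Res.…ordZero_monomial_one`; the translate / binomial formulas of
`Res.BinomialPointOrder`. [cite: ZariskiSamuel1960, Vol. II Ch. VII §1 pp.129–131 (order of a power series:
o(f + g) ≥ min, o(fg) = o(f) + o(g) over a domain, the ideal 𝔪ⁿ = series of order ≥ n)]
-/

open MvPolynomial

open scoped BigOperators

namespace Literature.AlgebraicGeometry.Resolution.Hauser2010

variable {σ : Type*} {K : Type*}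

section Semiring

variable [CommSemiring K]

/-- Unfolding: `ord₀ P` is the `MvPowerSeries.order` of `P`. [cite: Hauser2010, §C (order of X at a point)] -/
theorem ordZero_def (P : MvPolynomial σ K) : ordZero P = (P : MvPowerSeries σ K).order := rfl

/-- `ord₀ P = ⊤ ↔ P = 0`. [cite: ZariskiSamuel1960, Vol. II Ch. VII §1 p.129 (order of a power series)] -/
theorem ordZero_eq_top_iff {P : MvPolynomial σ K} : ordZero P = ⊤ ↔ P = 0 := by
  rw [ordZero_def, MvPowerSeries.order_eq_top_iff, MvPolynomial.coe_eq_zero_iff]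

/-- A non-zero polynomial has finite order. [cite: ZariskiSamuel1960, Vol. II Ch. VII §1 p.129 (order of a power series)] -/
theorem exists_ordZero_eq_natCast {P : MvPolynomial σ K} (hP : P ≠ 0) : ∃ n : ℕ, ordZero P = n :=
  ⟨(ordZero P).toNat, (ENat.coe_toNat fun h => hP (ordZero_eq_top_iff.mp h)).symm⟩

/-- A polynomial of finite order is non-zero. [cite: ZariskiSamuel1960, Vol. II Ch. VII §1 p.129 (order of a power series)] -/
theorem ne_zero_of_ordZero_eq_natCast {P : MvPolynomial σ K} {n : ℕ} (h : ordZero P = n) : P ≠ 0 := by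
  rintro rfl
  rw [ordZero_zero] at h
  exact ENat.top_ne_coe _ h

/-- `↑(ord₀ P).toNat = ord₀ P` for `P ≠ 0`. [cite: ZariskiSamuel1960, Vol. II Ch. VII §1 p.129 (order of a power series)] -/
theorem coe_toNat_ordZero {P : MvPolynomial σ K} (hP : P ≠ 0) : ((ordZero P).toNat : ℕ∞) = ordZero P :=
  ENat.coe_toNat fun h => hP (ordZero_eq_top_iff.mp h)

/-- `q ≤ (ord₀ P).toNat ↔ ↑q ≤ ord₀ P` for `P ≠ 0`. [cite: ZariskiSamuel1960, Vol. II Ch. VII §1 p.129 (order of a power series)] -/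
theorem le_toNat_ordZero_iff {P : MvPolynomial σ K} (hP : P ≠ 0) {q : ℕ} :
    q ≤ (ordZero P).toNat ↔ (q : ℕ∞) ≤ ordZero P := by
  rw [← coe_toNat_ordZero hP, Nat.cast_le, coe_toNat_ordZero hP]

/-- Coefficients below the order vanish. [cite: ZariskiSamuel1960, Vol. II Ch. VII §1 p.129 (order of a power series)] -/
theorem coeff_eq_zero_of_degree_lt_ordZero {P : MvPolynomial σ K} {d : σ →₀ ℕ}
    (h : (d.degree : ℕ∞) < ordZero P) : coeff d P = 0 := by
  have := MvPowerSeries.coeff_of_lt_order (f := (P : MvPowerSeries σ K)) h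
  rwa [MvPolynomial.coeff_coe] at this

/-- `n ≤ ord₀ P ↔` every coefficient of degree `< n` vanishes (the support form is
`…HauserPerlega.natCast_le_ordZero_iff`). [cite: ZariskiSamuel1960, Vol. II Ch. VII §1 p.129 (order of a power series)] -/
theorem natCast_le_ordZero_iff_forall_coeff (P : MvPolynomial σ K) (n : ℕ) :
    (n : ℕ∞) ≤ ordZero P ↔ ∀ d : σ →₀ ℕ, d.degree < n → coeff d P = 0 := by
  constructor
  · intro h d hd
    exact coeff_eq_zero_of_degree_lt_ordZero (lt_of_lt_of_le (by exact_mod_cast hd) h)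
  · intro h
    exact MvPowerSeries.nat_le_order fun d hd => by rw [MvPolynomial.coeff_coe]; exact h d hd

/-- **The bridge `ord₀` ↔ powers of the ideal of the variables: `n ≤ ord₀ P ↔ P ∈ 𝔪₀ⁿ`**, `𝔪₀ = idealOfVars σ K`.
[cite: ZariskiSamuel1960, Vol. II Ch. VII §1 p.130 (the ideal of series of order ≥ n is 𝔪ⁿ)] -/
theorem natCast_le_ordZero_iff_mem_idealOfVars_pow (P : MvPolynomial σ K) (n : ℕ) :
    (n : ℕ∞) ≤ ordZero P ↔ P ∈ MvPolynomial.idealOfVars σ K ^ n := by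
  rw [natCast_le_ordZero_iff_forall_coeff, MvPolynomial.mem_pow_idealOfVars_iff']

/-- `1 ≤ ord₀ P ↔ P(0) = 0`. [cite: ZariskiSamuel1960, Vol. II Ch. VII §1 p.129 (order of a power series)] -/
theorem one_le_ordZero_iff (P : MvPolynomial σ K) : 1 ≤ ordZero P ↔ constantCoeff P = 0 := by
  rw [show (1 : ℕ∞) = ((1 : ℕ) : ℕ∞) from rfl, natCast_le_ordZero_iff_forall_coeff]
  constructor
  · intro h
    exact h 0 (by simp)
  · intro h d hd
    rw [Nat.lt_one_iff, Finsupp.degree_eq_zero_iff] at hd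
    subst hd
    exact h

/-- `1 ≤ ord₀ P ↔ P ∈ 𝔪₀`. [cite: ZariskiSamuel1960, Vol. II Ch. VII §1 p.130 (series of positive order form 𝔪)] -/
theorem one_le_ordZero_iff_mem_idealOfVars (P : MvPolynomial σ K) :
    1 ≤ ordZero P ↔ P ∈ MvPolynomial.idealOfVars σ K := by
  rw [show (1 : ℕ∞) = ((1 : ℕ) : ℕ∞) from rfl, natCast_le_ordZero_iff_mem_idealOfVars_pow, pow_one]

/-- **`ord₀ P = 0 ↔ P(0) ≠ 0`.** [cite: ZariskiSamuel1960, Vol. II Ch. VII §1 p.129 (order zero = unit constant term)] -/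
theorem ordZero_eq_zero_iff (P : MvPolynomial σ K) : ordZero P = 0 ↔ constantCoeff P ≠ 0 := by
  rw [Ne, ← (one_le_ordZero_iff P).not, Order.one_le_iff_ne_zero, Ne, not_not]

/-! ### Algebra -/

/-- `ord₀ P + ord₀ Q ≤ ord₀ (P Q)` (any coefficients). [cite: ZariskiSamuel1960, Vol. II Ch. VII §1 p.130 (o(fg) ≥ o(f) + o(g))] -/
theorem le_ordZero_mul (P Q : MvPolynomial σ K) : ordZero P + ordZero Q ≤ ordZero (P * Q) := by
  simp only [ordZero_def, MvPolynomial.coe_mul]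
  exact MvPowerSeries.le_order_mul

/-- `ord₀ Q ≤ ord₀ (P Q)`. [cite: ZariskiSamuel1960, Vol. II Ch. VII §1 p.130 (o(fg) ≥ o(f) + o(g))] -/
theorem le_ordZero_mul_left (P Q : MvPolynomial σ K) : ordZero Q ≤ ordZero (P * Q) :=
  le_trans (by simp) (le_ordZero_mul P Q)

/-- `ord₀ P ≤ ord₀ (P Q)`. [cite: ZariskiSamuel1960, Vol. II Ch. VII §1 p.130 (o(fg) ≥ o(f) + o(g))] -/
theorem le_ordZero_mul_right (P Q : MvPolynomial σ K) : ordZero P ≤ ordZero (P * Q) :=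
  le_trans (by simp) (le_ordZero_mul P Q)

/-- `n · ord₀ P ≤ ord₀ (Pⁿ)` (any coefficients). [cite: ZariskiSamuel1960, Vol. II Ch. VII §1 p.130 (o(fg) ≥ o(f) + o(g))] -/
theorem le_ordZero_pow (P : MvPolynomial σ K) (n : ℕ) : (n : ℕ∞) * ordZero P ≤ ordZero (P ^ n) := by
  simp only [ordZero_def, MvPolynomial.coe_pow, ← nsmul_eq_mul]
  exact MvPowerSeries.le_order_pow n

/-- `min (ord₀ P) (ord₀ Q) ≤ ord₀ (P + Q)`. [cite: ZariskiSamuel1960, Vol. II Ch. VII §1 p.130 (o(f + g) ≥ min(o(f), o(g)))] -/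
theorem min_ordZero_le_ordZero_add (P Q : MvPolynomial σ K) : min (ordZero P) (ordZero Q) ≤ ordZero (P + Q) := by
  simp only [ordZero_def, MvPolynomial.coe_add]
  exact MvPowerSeries.min_order_le_add

/-- `n ≤ ord₀ P`, `n ≤ ord₀ Q ⇒ n ≤ ord₀ (P + Q)`. [cite: ZariskiSamuel1960, Vol. II Ch. VII §1 p.130 (o(f + g) ≥ min(o(f), o(g)))] -/
theorem le_ordZero_add {P Q : MvPolynomial σ K} {n : ℕ∞} (hP : n ≤ ordZero P) (hQ : n ≤ ordZero Q) :
    n ≤ ordZero (P + Q) :=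
  (le_min hP hQ).trans (min_ordZero_le_ordZero_add P Q)

/-- `ord₀ (P + Q) = min` when the orders differ. [cite: ZariskiSamuel1960, Vol. II Ch. VII §1 p.130 (equality when o(f) ≠ o(g))] -/
theorem ordZero_add_of_ordZero_ne {P Q : MvPolynomial σ K} (h : ordZero P ≠ ordZero Q) :
    ordZero (P + Q) = min (ordZero P) (ordZero Q) := by
  simp only [ordZero_def, MvPolynomial.coe_add] at h ⊢
  exact MvPowerSeries.order_add_of_order_ne h

/-- `ord₀ (P + Q) = ord₀ P` when `ord₀ P < ord₀ Q`. [cite: ZariskiSamuel1960, Vol. II Ch. VII §1 p.130 (equality when o(f) ≠ o(g))] -/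
theorem ordZero_add_eq_left_of_lt {P Q : MvPolynomial σ K} (h : ordZero P < ordZero Q) :
    ordZero (P + Q) = ordZero P := by
  rw [ordZero_add_of_ordZero_ne h.ne, min_eq_left h.le]

/-- `ord₀ (P + Q) = ord₀ Q` when `ord₀ Q < ord₀ P`. [cite: ZariskiSamuel1960, Vol. II Ch. VII §1 p.130 (equality when o(f) ≠ o(g))] -/
theorem ordZero_add_eq_right_of_lt {P Q : MvPolynomial σ K} (h : ordZero Q < ordZero P) :
    ordZero (P + Q) = ordZero Q := by
  rw [add_comm, ordZero_add_eq_left_of_lt h]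

/-- A finite sum of polynomials of order `≥ n` has order `≥ n`. [cite: ZariskiSamuel1960, Vol. II Ch. VII §1 p.130 (o(f + g) ≥ min)] -/
theorem le_ordZero_sum {ι : Type*} (s : Finset ι) (f : ι → MvPolynomial σ K) {n : ℕ∞}
    (h : ∀ i ∈ s, n ≤ ordZero (f i)) : n ≤ ordZero (∑ i ∈ s, f i) := by
  classical
  induction s using Finset.induction_on with
  | empty => simp [ordZero_zero]
  | insert a s ha ih =>
    rw [Finset.sum_insert ha]
    exact le_ordZero_add (h a (Finset.mem_insert_self a s)) (ih fun i hi => h i (Finset.mem_insert_of_mem hi))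

/-- `ord₀ P ≤ ord₀ (C c · P)`. [cite: ZariskiSamuel1960, Vol. II Ch. VII §1 p.130 (o(fg) ≥ o(f) + o(g))] -/
theorem le_ordZero_C_mul (c : K) (P : MvPolynomial σ K) : ordZero P ≤ ordZero (C c * P) :=
  le_ordZero_mul_left _ _

/-- `ord₀ (C u · P) = ord₀ P` for a unit `u`. [cite: ZariskiSamuel1960, Vol. II Ch. VII §1 p.130 (units have order 0)] -/
theorem ordZero_C_mul_of_isUnit {u : K} (hu : IsUnit u) (P : MvPolynomial σ K) : ordZero (C u * P) = ordZero P := by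
  refine le_antisymm ?_ (le_ordZero_C_mul u P)
  obtain ⟨v, hv⟩ := hu.exists_left_inv
  calc ordZero (C u * P) ≤ ordZero (C v * (C u * P)) := le_ordZero_C_mul v _
    _ = ordZero P := by rw [← mul_assoc, ← map_mul, hv, map_one, one_mul]

/-! ### Values -/

/-- `ord₀ (c · X^d) = |d|` for `c ≠ 0` (the case `c = 1` is `Res.…ordZero_monomial_one`).
[cite: ZariskiSamuel1960, Vol. II Ch. VII §1 p.129 (order of a form of degree n is n)] -/
theorem ordZero_monomial (d : σ →₀ ℕ) {c : K} (hc : c ≠ 0) : ordZero (monomial d c) = d.degree := by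
  rw [ordZero_def, MvPolynomial.coe_monomial, MvPowerSeries.order_monomial_of_ne_zero hc]

/-- `ord₀ (X_i ^ n) = n`. [cite: ZariskiSamuel1960, Vol. II Ch. VII §1 p.129 (order of a form of degree n is n)] -/
theorem ordZero_X_pow [Nontrivial K] (i : σ) (n : ℕ) : ordZero ((X i : MvPolynomial σ K) ^ n) = n := by
  rw [X_pow_eq_monomial, ordZero_monomial _ (one_ne_zero' K), Finsupp.degree_single]

/-- `ord₀ (X_i) = 1`. [cite: ZariskiSamuel1960, Vol. II Ch. VII §1 p.129 (order of a form of degree n is n)] -/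
theorem ordZero_X [Nontrivial K] (i : σ) : ordZero (X i : MvPolynomial σ K) = 1 := by
  simpa using ordZero_X_pow (K := K) i 1

/-- `ord₀ (C c) = 0` for `c ≠ 0`. [cite: ZariskiSamuel1960, Vol. II Ch. VII §1 p.129 (order zero = non-zero constant term)] -/
theorem ordZero_C {c : K} (hc : c ≠ 0) : ordZero (C c : MvPolynomial σ K) = 0 := by
  rw [ordZero_eq_zero_iff, constantCoeff_C]
  exact hc

/-- `ord₀ 1 = 0`. [cite: ZariskiSamuel1960, Vol. II Ch. VII §1 p.129 (order zero = non-zero constant term)] -/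
theorem ordZero_one [Nontrivial K] : ordZero (1 : MvPolynomial σ K) = 0 := by
  rw [ordZero_eq_zero_iff, map_one]
  exact one_ne_zero

/-- A homogeneous polynomial of degree `n` has order `≥ n`. [cite: ZariskiSamuel1960, Vol. II Ch. VII §1 p.129 (order of a form)] -/
theorem le_ordZero_of_isHomogeneous {P : MvPolynomial σ K} {n : ℕ} (hP : P.IsHomogeneous n) : (n : ℕ∞) ≤ ordZero P := by
  rw [natCast_le_ordZero_iff_forall_coeff]
  intro d hd
  exact hP.coeff_eq_zero hd.ne

/-- **A non-zero homogeneous polynomial of degree `n` has order exactly `n`.**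
[cite: ZariskiSamuel1960, Vol. II Ch. VII §1 p.129 (order of a form of degree n is n)] -/
theorem ordZero_of_isHomogeneous {P : MvPolynomial σ K} {n : ℕ} (hP : P.IsHomogeneous n) (h0 : P ≠ 0) :
    ordZero P = n := by
  refine le_antisymm ?_ (le_ordZero_of_isHomogeneous hP)
  obtain ⟨d, hd⟩ := MvPolynomial.ne_zero_iff.mp h0
  have hdeg : d.degree = n := by
    by_contra hne
    exact hd (hP.coeff_eq_zero hne)
  rw [← hdeg, ordZero_def]
  exact MvPowerSeries.order_le (by rwa [MvPolynomial.coeff_coe])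

/-! ### Change of coefficients -/

/-- `ord₀ P ≤ ord₀ (map f P)` for any ring map `f`. [cite: ZariskiSamuel1960, Vol. II Ch. VII §1 p.129 (order of a power series)] -/
theorem le_ordZero_map {L : Type*} [CommSemiring L] (f : K →+* L) (P : MvPolynomial σ K) :
    ordZero P ≤ ordZero (MvPolynomial.map f P) := by
  rcases eq_or_ne P 0 with rfl | hP
  · simp [ordZero_zero]
  obtain ⟨n, hn⟩ := exists_ordZero_eq_natCast hP
  rw [hn, natCast_le_ordZero_iff_forall_coeff]
  intro d hd
  rw [MvPolynomial.coeff_map, coeff_eq_zero_of_degree_lt_ordZero (by rw [hn]; exact_mod_cast hd), map_zero]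

/-- `ord₀ (map f P) = ord₀ P` for an injective ring map `f`. [cite: ZariskiSamuel1960, Vol. II Ch. VII §1 p.129 (order of a power series)] -/
theorem ordZero_map_of_injective {L : Type*} [CommSemiring L] {f : K →+* L} (hf : Function.Injective f)
    (P : MvPolynomial σ K) : ordZero (MvPolynomial.map f P) = ordZero P := by
  refine le_antisymm ?_ (le_ordZero_map f P)
  rcases eq_or_ne P 0 with rfl | hP
  · simp [ordZero_zero]
  obtain ⟨n, hn⟩ := exists_ordZero_eq_natCast hP
  obtain ⟨⟨d, hd, hdeg⟩, -⟩ := (ordZero_eq_nat_iff P n).mp hn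
  rw [hn, ← hdeg, ordZero_def]
  refine MvPowerSeries.order_le ?_
  rw [MvPolynomial.coeff_coe, MvPolynomial.coeff_map]
  exact fun h => hd (hf (by rw [h, map_zero]))

end Semiring

section Ring

variable [CommRing K]

/-- `ord₀ (−P) = ord₀ P` (Summits-side twin: `…W46MohWindowShadeFormalBranch`'s `ordZero_neg`). [cite: ZariskiSamuel1960, Vol. II Ch. VII §1 p.129 (order of a power series)] -/
theorem ordZero_neg (P : MvPolynomial σ K) : ordZero (-P) = ordZero P := by
  rw [ordZero_def, ordZero_def, ← MvPowerSeries.order_neg (P : MvPowerSeries σ K),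
    ← MvPolynomial.coeToMvPowerSeries.ringHom_apply, map_neg, MvPolynomial.coeToMvPowerSeries.ringHom_apply]

/-- `ord₀ (P − Q) = ord₀ (Q − P)`. [cite: ZariskiSamuel1960, Vol. II Ch. VII §1 p.129 (order of a power series)] -/
theorem ordZero_sub_comm (P Q : MvPolynomial σ K) : ordZero (P - Q) = ordZero (Q - P) := by
  rw [← neg_sub, ordZero_neg]

/-- `min (ord₀ P) (ord₀ Q) ≤ ord₀ (P − Q)`. [cite: ZariskiSamuel1960, Vol. II Ch. VII §1 p.130 (o(f + g) ≥ min)] -/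
theorem min_ordZero_le_ordZero_sub (P Q : MvPolynomial σ K) : min (ordZero P) (ordZero Q) ≤ ordZero (P - Q) := by
  rw [sub_eq_add_neg, ← ordZero_neg Q]
  exact min_ordZero_le_ordZero_add P (-Q)

/-- `n ≤ ord₀ P`, `n ≤ ord₀ Q ⇒ n ≤ ord₀ (P − Q)`. [cite: ZariskiSamuel1960, Vol. II Ch. VII §1 p.130 (o(f + g) ≥ min)] -/
theorem le_ordZero_sub {P Q : MvPolynomial σ K} {n : ℕ∞} (hP : n ≤ ordZero P) (hQ : n ≤ ordZero Q) :
    n ≤ ordZero (P - Q) :=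
  (le_min hP hQ).trans (min_ordZero_le_ordZero_sub P Q)

/-- `ord₀ (P − Q) = ord₀ P` when `ord₀ P < ord₀ Q`. [cite: ZariskiSamuel1960, Vol. II Ch. VII §1 p.130 (equality when o(f) ≠ o(g))] -/
theorem ordZero_sub_eq_left_of_lt {P Q : MvPolynomial σ K} (h : ordZero P < ordZero Q) :
    ordZero (P - Q) = ordZero P := by
  rw [sub_eq_add_neg, ordZero_add_eq_left_of_lt (by rwa [ordZero_neg])]

end Ring

section NoZeroDivisors

variable [CommSemiring K] [NoZeroDivisors K]

/-- **`ord₀ (P Q) = ord₀ P + ord₀ Q`** when `K` has no zero divisors (Summits-side twin, not importable here: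
`…Theorems.MarkedTransferCampaignW46MohWindowShadeFormalBranch`'s `ordZero_mul`, over a field).
[cite: ZariskiSamuel1960, Vol. II Ch. VII §1 p.130 (o(fg) = o(f) + o(g) over an integral domain)] -/
theorem ordZero_mul (P Q : MvPolynomial σ K) : ordZero (P * Q) = ordZero P + ordZero Q := by
  simp only [ordZero_def, MvPolynomial.coe_mul]
  exact MvPowerSeries.order_mul _ _

/-- `ord₀ (Pⁿ) = n · ord₀ P` when `K` has no zero divisors (and `0 ≠ 1`) (Summits-side twin: `…W46MohWindowShadeFormalBranch`'s
`ordZero_pow`).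
[cite: ZariskiSamuel1960, Vol. II Ch. VII §1 p.130 (o(fg) = o(f) + o(g) over an integral domain)] -/
theorem ordZero_pow [Nontrivial K] (P : MvPolynomial σ K) (n : ℕ) : ordZero (P ^ n) = n * ordZero P := by
  induction n with
  | zero => rw [pow_zero, ordZero_one, Nat.cast_zero, zero_mul]
  | succ n ih => rw [pow_succ, ordZero_mul, ih, Nat.cast_succ, add_mul, one_mul]

/-- `ord₀ (∏ f_i) = Σ ord₀ f_i` when `K` has no zero divisors (and `0 ≠ 1`).
[cite: ZariskiSamuel1960, Vol. II Ch. VII §1 p.130 (o(fg) = o(f) + o(g) over an integral domain)] -/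
theorem ordZero_prod [Nontrivial K] {ι : Type*} (s : Finset ι) (f : ι → MvPolynomial σ K) :
    ordZero (∏ i ∈ s, f i) = ∑ i ∈ s, ordZero (f i) := by
  classical
  induction s using Finset.induction_on with
  | empty => simp [ordZero_one]
  | insert a s ha ih => rw [Finset.prod_insert ha, Finset.sum_insert ha, ordZero_mul, ih]

/-- `ord₀ (C c · P) = ord₀ P` for `c ≠ 0` when `K` has no zero divisors.
[cite: ZariskiSamuel1960, Vol. II Ch. VII §1 p.130 (o(fg) = o(f) + o(g) over an integral domain)] -/
theorem ordZero_C_mul {c : K} (hc : c ≠ 0) (P : MvPolynomial σ K) : ordZero (C c * P) = ordZero P := by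
  rw [ordZero_mul, ordZero_C hc, zero_add]

end NoZeroDivisors

/-! ## §2 Certificates for an exact order (librarian APPEND, res-D-lib-2 gen 10)

How the explicit bed computations pin `ord₀ P = n`: a LOWER bound `P ∈ 𝔪₀ⁿ` (or: all coefficients of degree `< n` vanish)
and an UPPER bound by ONE non-zero coefficient of degree `n`; plus the monotonicity of `ord₀` under substitutions with vanishing
constant terms (`ord₀ q ≤ ord₀ (q ∘ f)`), so that an order computed after a «collapse» substitution bounds `ord₀ q` from above.
[cite: ZariskiSamuel1960, Vol. II Ch. VII §1 pp.129–131 (order of a power series; the ideal 𝔪ⁿ = series of order ≥ n)] -/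

section Certificates

variable [CommSemiring K]

/-- **`ord₀ P = n ↔ P ∈ 𝔪₀ⁿ ∧ P ∉ 𝔪₀ⁿ⁺¹`.** [cite: ZariskiSamuel1960, Vol. II Ch. VII §1 p.130 (the ideal 𝔪ⁿ = series of order ≥ n)] -/
theorem ordZero_eq_natCast_iff_mem_and_notMem (P : MvPolynomial σ K) (n : ℕ) :
    ordZero P = n ↔ P ∈ MvPolynomial.idealOfVars σ K ^ n ∧ P ∉ MvPolynomial.idealOfVars σ K ^ (n + 1) := by
  rw [← natCast_le_ordZero_iff_mem_idealOfVars_pow, ← natCast_le_ordZero_iff_mem_idealOfVars_pow, not_le,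
    Nat.cast_add, Nat.cast_one, ENat.lt_add_one_iff (ENat.coe_ne_top n)]
  exact ⟨fun h => ⟨h.ge, h.le⟩, fun h => le_antisymm h.2 h.1⟩

/-- `ord₀ P < n ↔ P ∉ 𝔪₀ⁿ`. [cite: ZariskiSamuel1960, Vol. II Ch. VII §1 p.130 (the ideal 𝔪ⁿ = series of order ≥ n)] -/
theorem ordZero_lt_natCast_iff_notMem (P : MvPolynomial σ K) (n : ℕ) :
    ordZero P < n ↔ P ∉ MvPolynomial.idealOfVars σ K ^ n := by
  rw [← natCast_le_ordZero_iff_mem_idealOfVars_pow, not_le]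

/-- **Certificate for `ord₀ P = n`: `P ∈ 𝔪₀ⁿ` and ONE non-zero coefficient of degree `n`.**
[cite: ZariskiSamuel1960, Vol. II Ch. VII §1 p.129 (order of a power series)] -/
theorem ordZero_eq_natCast_of_mem_of_coeff_ne_zero {P : MvPolynomial σ K} {n : ℕ}
    (hmem : P ∈ MvPolynomial.idealOfVars σ K ^ n) {d : σ →₀ ℕ} (hd : d.degree = n) (h : coeff d P ≠ 0) :
    ordZero P = n := by
  refine le_antisymm ?_ ((natCast_le_ordZero_iff_mem_idealOfVars_pow P n).mpr hmem)
  rw [← hd, ordZero_def]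
  exact MvPowerSeries.order_le (by rwa [MvPolynomial.coeff_coe])

/-- Certificate for `ord₀ P = n`, coefficientwise: all coefficients of degree `< n` vanish and one of degree `n` does not
(`Hauser2010.ordZero_eq_nat_iff` repackaged with the witness as separate arguments).
[cite: ZariskiSamuel1960, Vol. II Ch. VII §1 p.129 (order of a power series)] -/
theorem ordZero_eq_natCast_of_forall_of_coeff_ne_zero {P : MvPolynomial σ K} {n : ℕ}
    (hlow : ∀ e : σ →₀ ℕ, e.degree < n → coeff e P = 0) {d : σ →₀ ℕ} (hd : d.degree = n) (h : coeff d P ≠ 0) :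
    ordZero P = n :=
  (ordZero_eq_nat_iff P n).mpr ⟨⟨d, h, hd⟩, hlow⟩

/-- **Substitutions with vanishing constant terms do not lower the order: `ord₀ q ≤ ord₀ (aeval f q)`** (`f_i(0) = 0` for all
`i`; e.g. the «collapse» of some variables onto one, or a monomial substitution). Hence an exact order computed AFTER such a
substitution bounds `ord₀ q` from above. [cite: ZariskiSamuel1960, Vol. II Ch. VII §1 p.131 (substitution of series of positive order)] -/
theorem le_ordZero_aeval {τ : Type*} (f : σ → MvPolynomial τ K) (hf : ∀ i, constantCoeff (f i) = 0)
    (q : MvPolynomial σ K) : ordZero q ≤ ordZero (aeval f q) := by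
  rcases eq_or_ne q 0 with rfl | hq
  · simp [ordZero_zero]
  obtain ⟨n, hn⟩ := exists_ordZero_eq_natCast hq
  rw [hn, natCast_le_ordZero_iff_mem_idealOfVars_pow]
  exact Literature.RingTheory.MvPolynomial.aeval_mem_idealOfVars_pow f hf
    ((natCast_le_ordZero_iff_mem_idealOfVars_pow q n).mp hn.ge)

/-- `ord₀ (aeval f q) < n ⇒ ord₀ q < n` for substitutions with vanishing constant terms.
[cite: ZariskiSamuel1960, Vol. II Ch. VII §1 p.131 (substitution of series of positive order)] -/
theorem ordZero_lt_of_ordZero_aeval_lt {τ : Type*} (f : σ → MvPolynomial τ K) (hf : ∀ i, constantCoeff (f i) = 0)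
    {q : MvPolynomial σ K} {n : ℕ∞} (h : ordZero (aeval f q) < n) : ordZero q < n :=
  lt_of_le_of_lt (le_ordZero_aeval f hf q) h

end Certificates

/-! ## §3 Initial form: `ordZero` ↔ `homogeneousComponent` (librarian APPEND, res-D-lib-2 gen 10)

The order at the origin is the least degree of a non-zero homogeneous component; the component of that degree is the initial form.
(Summits-side twins, not importable here: `Rescue.BedSlopeResidualWQ`'s `ordZero_eq_of_mem_pow_of_hom_ne_zero`,
`KangarooAtlas.PointBlowupLayerFormula`'s `homogeneousComponent_eq_zero_of_lt`.)
[cite: ZariskiSamuel1960, Vol. II Ch. VII §1 pp.129–130 (order = degree of the initial form; leading form of a power series)] -/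

section InitialForm

variable [CommSemiring K]

/-- Homogeneous components of degree below the order vanish.
[cite: ZariskiSamuel1960, Vol. II Ch. VII §1 p.130 (initial form of a power series)] -/
theorem homogeneousComponent_eq_zero_of_lt_ordZero {P : MvPolynomial σ K} {k : ℕ} (h : (k : ℕ∞) < ordZero P) :
    homogeneousComponent k P = 0 := by
  refine homogeneousComponent_eq_zero' k P fun d hd hdk => ?_
  have hlt : (d.degree : ℕ∞) < ordZero P := by rw [hdk]; exact h
  exact (MvPolynomial.mem_support_iff.mp hd) (coeff_eq_zero_of_degree_lt_ordZero hlt)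

/-- `n ≤ ord₀ P ↔` all homogeneous components of degree `< n` vanish.
[cite: ZariskiSamuel1960, Vol. II Ch. VII §1 p.130 (initial form of a power series)] -/
theorem natCast_le_ordZero_iff_forall_homogeneousComponent_eq_zero (P : MvPolynomial σ K) (n : ℕ) :
    (n : ℕ∞) ≤ ordZero P ↔ ∀ k < n, homogeneousComponent k P = 0 := by
  constructor
  · intro h k hk
    exact homogeneousComponent_eq_zero_of_lt_ordZero (lt_of_lt_of_le (by exact_mod_cast hk) h)
  · intro h
    rw [natCast_le_ordZero_iff_forall_coeff]
    intro d hd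
    have := congr_arg (coeff d) (h d.degree hd)
    rwa [coeff_homogeneousComponent, if_pos rfl, coeff_zero] at this

/-- The homogeneous component in the degree of the order is non-zero (the INITIAL FORM).
[cite: ZariskiSamuel1960, Vol. II Ch. VII §1 p.130 (initial form of a power series)] -/
theorem homogeneousComponent_ne_zero_of_ordZero_eq {P : MvPolynomial σ K} {n : ℕ} (h : ordZero P = n) :
    homogeneousComponent n P ≠ 0 := by
  obtain ⟨⟨d, hd, hdeg⟩, -⟩ := (ordZero_eq_nat_iff P n).mp h
  intro h0
  have := congr_arg (coeff d) h0
  rw [coeff_homogeneousComponent, if_pos hdeg, coeff_zero] at this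
  exact hd this

/-- **`ord₀ P = n ↔` the homogeneous components below degree `n` vanish and the one of degree `n` does not.**
[cite: ZariskiSamuel1960, Vol. II Ch. VII §1 p.130 (order = degree of the initial form)] -/
theorem ordZero_eq_natCast_iff_homogeneousComponent (P : MvPolynomial σ K) (n : ℕ) :
    ordZero P = n ↔ (∀ k < n, homogeneousComponent k P = 0) ∧ homogeneousComponent n P ≠ 0 := by
  rw [← natCast_le_ordZero_iff_forall_homogeneousComponent_eq_zero]
  constructor
  · exact fun h => ⟨h.ge, homogeneousComponent_ne_zero_of_ordZero_eq h⟩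
  · rintro ⟨hle, hne⟩
    refine le_antisymm ?_ hle
    by_contra hlt
    exact hne (homogeneousComponent_eq_zero_of_lt_ordZero (not_le.mp hlt))

/-- **Certificate by the initial form: `P ∈ 𝔪₀ⁿ` and `homogeneousComponent n P ≠ 0 ⇒ ord₀ P = n`** (Summits-side twin:
`BedSlopeResidualWQ.ordZero_eq_of_mem_pow_of_hom_ne_zero`).
[cite: ZariskiSamuel1960, Vol. II Ch. VII §1 p.130 (order = degree of the initial form)] -/
theorem ordZero_eq_natCast_of_mem_of_homogeneousComponent_ne_zero {P : MvPolynomial σ K} {n : ℕ}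
    (hmem : P ∈ MvPolynomial.idealOfVars σ K ^ n) (h : homogeneousComponent n P ≠ 0) : ordZero P = n := by
  rw [ordZero_eq_natCast_iff_homogeneousComponent]
  exact ⟨(natCast_le_ordZero_iff_forall_homogeneousComponent_eq_zero P n).mp
    ((natCast_le_ordZero_iff_mem_idealOfVars_pow P n).mpr hmem), h⟩

/-- A non-zero homogeneous component has order equal to its degree.
[cite: ZariskiSamuel1960, Vol. II Ch. VII §1 p.129 (order of a form of degree n is n)] -/
theorem ordZero_homogeneousComponent {P : MvPolynomial σ K} {n : ℕ} (h : homogeneousComponent n P ≠ 0) :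
    ordZero (homogeneousComponent n P) = n :=
  ordZero_of_isHomogeneous (homogeneousComponent_isHomogeneous n P) h

end InitialForm

section InitialFormRing

variable [CommRing K]

/-- Removing the homogeneous component of degree `n` from a polynomial of order `≥ n` leaves order `≥ n + 1`
(`P ≡ in(P)` modulo higher order). [cite: ZariskiSamuel1960, Vol. II Ch. VII §1 p.130 (initial form of a power series)] -/
theorem succ_le_ordZero_sub_homogeneousComponent {P : MvPolynomial σ K} {n : ℕ} (h : (n : ℕ∞) ≤ ordZero P) :
    ((n + 1 : ℕ) : ℕ∞) ≤ ordZero (P - homogeneousComponent n P) := by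
  rw [natCast_le_ordZero_iff_forall_coeff]
  intro d hd
  rw [coeff_sub, coeff_homogeneousComponent]
  rcases Nat.lt_succ_iff_lt_or_eq.mp hd with hlt | heq
  · rw [if_neg hlt.ne, sub_zero]
    exact coeff_eq_zero_of_degree_lt_ordZero (lt_of_lt_of_le (by exact_mod_cast hlt) h)
  · rw [if_pos heq, sub_self]

end InitialFormRing

end Literature.AlgebraicGeometry.Resolution.Hauser2010
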